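import Summits.PneNP.PneNP.Theorems.ConvexRankGatesCliqueExtLowerBoundWidthThresholdNarrow
import Summits.PneNP.PneNP.Theorems.ConvexRankGatesCliqueExtLowerBoundThresholdLowerBound
import Summits.PneNP.PneNP.Theorems.ConvexRankGatesCliqueExtLowerBoundRealInline
import Summits.PneNP.PneNP.Theorems.ConvexRankGatesCliqueExtLowerBoundRealGateSandwich
import Summits.PneNP.PneNP.Theorems.ConvexRankGatesCliqueExtLowerBoundConvFewRowsProgram
import Summits.PneNP.PneNP.Theorems.ConvexRankGatesCliqueExtLowerBoundConvBoundedDimProgram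
import Literature.Computability.Complexity.MonotoneRealLeafPairs

/-!
# Wide gates that are short monotone REAL programs are free; CONV gates with few rows or bounded psd dimension
(crux `ConvexRankGates.CliqueExtLowerBound`, stmt-PneNP-10682; line `width-threshold-certificate-sparsity`, reshape r6)

The REAL-GATE ENGINE (Jukna 2012, Thm 9.21, criterion for monotone real circuits — leaf-pair form,
`Literature/…/MonotoneRealLeafPairs.realProgram_exists_pairApproximators`) composed with the landed
registered stubs of r6:

* `engine_statement` / `realInline_statement` / `realGate_statement` — the engine in the `Type`-level
  form, real inline freeness (`RealInline.realInline_of_engine`, p119986) and: every gate with the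
  CLASS-PROGRAM PROPERTY at exponent `c` (on inputs constant on the classes of any class map it is a
  threshold of a monotone real straight-line program of length `≤ m^c (#classes + 1)` and fan-in
  `≤ ⌊m^{1/16}⌋₊`) is sandwichable on the referee pair (`RealGate.realGate_of_realInline`, p120019);
* `realProgram_monotone`, `classProgram_monotone` — such gates are monotone;
* `fewRowsConv_statement` — CONV gates with `p ≤ ⌊m^{1/16}⌋₊` rows (any psd dimension) are sandwichable
  (`ConvFewRows.conv_fewRows_classProgram`);
* `boundedDimConv_statement Q` — CONV gates with psd dimension `q ≤ Q` (any number of rows) are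
  sandwichable (`ConvBoundedDim.conv_boundedDim_classProgram` at exponent `(c+1)(Q²+2)+1`, weakened);
* `realGates_lowerBound` (REGISTERED) — UNCONDITIONAL: for every `Q` and `c`, eventually in `m`, no
  circuit with `≤ m^c` gates over `{∧₂,∨₂}` ∪ (all gates with the class-program property at `c`) ∪
  (CONV gates of width `≤ m^c` with `≤ ⌊m^{1/16}⌋₊` rows OR psd dimension `≤ Q`) ∪
  (PERM/GRANK gates of width `≤ ⌊m^{1/16}⌋₊`) computes `CLIQUE(m, ⌈m^{1/4}⌉₊)`. This contains every
  monotone real circuit of bounded fan-in (Pudlák 1997 / Haken–Cook 1999 / Jukna 1999 for this pair),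
  every real threshold or polynomial-threshold gate of any fan-in, every LP gate with few constraints
  and every SDP/SOCP gate of bounded dimension.

Lead prover seat `prover-line-stmt-PneNP-10682-c2`, 2026-08-16.
-/

set_option linter.dupNamespace false

open Literature.Computability.Complexity Filter Finset
open Summit.PneNP.PneNP.Theorems.CliqueExtLowerBound.WidthThreshold

noncomputable section

namespace Summit.PneNP.PneNP.Theorems.CliqueExtLowerBound.WidthThreshold.RealGateLowerBound

/-! ## §1 The engine and its two landed consequences -/

/-- **THE REAL-GATE ENGINE** (Jukna 2012 Thm 9.21, leaf-pair form; LANDED as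
`realProgram_exists_pairApproximators`) in the `Type`-level form consumed by `realInline_of_engine`.
[cite: Jukna2012, Thm. 9.21] -/
theorem engine_statement :
    ∀ (ι : Type) [Fintype ι] [DecidableEq ι] (n r s T K : ℕ) (Dl Cl : Fin n → Finset (Finset ι))
    (cv dv : (ι → Bool) → Fin n → Bool),
    (∀ j, ∀ R ∈ Dl j, #R ≤ r - 1) → (∀ j, ∀ S ∈ Cl j, #S ≤ s - 1) →
    (∀ j x, EvalDNF (Dl j) x → EvalCNF (Cl j) x) →
    (∀ j x, EvalCNF (Cl j) x → cv x j = true) → (∀ j x, dv x j = true → EvalDNF (Dl j) x) →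
    ∀ ev : (Fin n → Bool) → Fin T → ℝ,
    (∀ t : Fin T, ∃ (k : ℕ) (src : Fin k → Fin n ⊕ Fin T) (φ : (Fin k → ℝ) → ℝ), k ≤ K ∧
      (∀ i t', src i = Sum.inr t' → t' < t) ∧ Monotone φ ∧
      ∀ u : Fin n → Bool, ev u t =
        φ (fun i => Sum.elim (fun j => if u j then (1 : ℝ) else 0) (ev u) (src i))) →
    ∃ Cf Df : Finset (Finset ι), (∀ P ∈ Cf, #P = s) ∧ (∀ P ∈ Df, #P = r) ∧
      #Cf ≤ T * (K * (r - 1)) ^ s ∧ #Df ≤ T * (s - 1) ^ r ∧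
      ∀ (t : Fin T) (a : ℝ), ∃ dnf cnf : Finset (Finset ι),
        (∀ R ∈ dnf, #R ≤ r - 1) ∧ (∀ S ∈ cnf, #S ≤ s - 1) ∧
        (∀ x, EvalDNF dnf x → EvalCNF cnf x) ∧
        (∀ x, EvalCNF Cf x → EvalCNF cnf x → a ≤ ev (cv x) t) ∧
        (∀ x, a ≤ ev (dv x) t → EvalDNF dnf x ∨ EvalDNF Df x) := by
  intro ι _ _ n r s T K Dl Cl cv dv hDl hCl hle hcv hdv ev hprog
  exact realProgram_exists_pairApproximators Dl Cl cv dv hDl hCl hle hcv hdv ev hprog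

open Classical in
/-- **REAL INLINE FREENESS** (`RealInline.realInline_of_engine`, p119986, fed with the engine): every
monotone real straight-line program of length `≤ m^a` and fan-in `≤ ⌊m^{1/16}⌋₊`, fed with local
pairs, has an output sandwich pair on the referee families. [cite: Jukna2012, Thm. 9.21] -/
theorem realInline_statement :
    ∀ a c : ℕ, ∃ r₀ s₀ : ℕ, 2 ≤ r₀ ∧ 2 ≤ s₀ ∧ ∀ r s : ℕ, r₀ ≤ r → s₀ ≤ s →
    ∀ᶠ m : ℕ in atTop,
      ∀ (n T K : ℕ) (ev : (Fin n → Bool) → Fin T → ℝ),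
      (∀ t : Fin T, ∃ (k : ℕ) (src : Fin k → Fin n ⊕ Fin T) (φ : (Fin k → ℝ) → ℝ), k ≤ K ∧
        (∀ i t', src i = Sum.inr t' → t' < t) ∧ Monotone φ ∧
        ∀ u : Fin n → Bool, ev u t =
          φ (fun i => Sum.elim (fun j => if u j then (1 : ℝ) else 0) (ev u) (src i))) →
      T ≤ m ^ a → K ≤ ⌊(m : ℝ) ^ (1 / 16 : ℝ)⌋₊ →
      ∀ (t : Fin T) (θ : ℝ) (D C : Fin n → Finset (Finset ((⊤ : SimpleGraph (Fin m)).edgeSet))),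
        (∀ j, ∀ R ∈ D j, #R ≤ r - 1) → (∀ j, ∀ S ∈ C j, #S ≤ s - 1) →
        (∀ j x, EvalDNF (D j) x → EvalCNF (C j) x) →
        ∃ dnf cnf : Finset (Finset ((⊤ : SimpleGraph (Fin m)).edgeSet)),
          (∀ R ∈ dnf, #R ≤ r - 1) ∧ (∀ S ∈ cnf, #S ≤ s - 1) ∧
          (∀ x, EvalDNF dnf x → EvalCNF cnf x) ∧
          (#((posGraphs m ⌈(m : ℝ) ^ (1 / 4 : ℝ)⌉₊).filter
              (fun x => θ ≤ ev (fun j => decide (EvalDNF (D j) x)) t ∧ ¬ EvalDNF dnf x)) : ℝ)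
            ≤ (1 / (8 * (m : ℝ) ^ (c + 1))) * #(posGraphs m ⌈(m : ℝ) ^ (1 / 4 : ℝ)⌉₊) ∧
          (#((((powersetCard (Fintype.card ((⊤ : SimpleGraph (Fin m)).edgeSet) / ⌊(m : ℝ) ^ (1 / 8 : ℝ)⌋₊)
          (univ : Finset ((⊤ : SimpleGraph (Fin m)).edgeSet))).image (fun M => fun e => decide (e ∉ M)))).filter
              (fun x => EvalCNF cnf x ∧ ¬ θ ≤ ev (fun j => decide (EvalCNF (C j) x)) t)) : ℝ)
            ≤ (1 / (8 * (m : ℝ) ^ (c + 1))) *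
              #(((powersetCard (Fintype.card ((⊤ : SimpleGraph (Fin m)).edgeSet) / ⌊(m : ℝ) ^ (1 / 8 : ℝ)⌋₊)
          (univ : Finset ((⊤ : SimpleGraph (Fin m)).edgeSet))).image (fun M => fun e => decide (e ∉ M)))) :=
  RealInline.realInline_of_engine engine_statement

/-- **REAL-COMPUTABLE GATES ARE SANDWICHABLE** (`RealGate.realGate_of_realInline`, p120019): the
class-program property at exponent `c` gives `Sandwichable r s (m^{c+3}) (posFam m) (negFam m) (eps m c)`.
[cite: Jukna2012, Thm. 9.21] -/
theorem realGate_statement : ∀ c : ℕ, ∃ r₀ s₀ : ℕ, 2 ≤ r₀ ∧ 2 ≤ s₀ ∧ ∀ r s : ℕ, r₀ ≤ r → s₀ ≤ s →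
    ∀ᶠ m : ℕ in atTop, ∀ φ : GateFn,
      (∀ (n' : ℕ) (cls : Fin φ.1 → Fin n'),
      ∃ (T K : ℕ) (ev : (Fin n' → Bool) → Fin T → ℝ) (t : Fin T) (θ : ℝ),
      T ≤ m ^ c * (n' + 1) ∧ K ≤ ⌊(m : ℝ) ^ (1 / 16 : ℝ)⌋₊ ∧
      (∀ w : Fin T, ∃ (k : ℕ) (src : Fin k → Fin n' ⊕ Fin T) (ψ : (Fin k → ℝ) → ℝ), k ≤ K ∧
      (∀ i t', src i = Sum.inr t' → t' < w) ∧ Monotone ψ ∧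
      ∀ u : Fin n' → Bool, ev u w =
      ψ (fun i => Sum.elim (fun j => if u j then (1 : ℝ) else 0) (ev u) (src i))) ∧
      ∀ u : Fin n' → Bool, φ.2 (fun j => u (cls j)) = true ↔ θ ≤ ev u t) →
      Sandwichable r s (m ^ (c + 3)) (posFam m) (negFam m) (eps m c) φ :=
  RealGate.realGate_of_realInline realInline_statement

/-! ## §2 Monotonicity -/

/-- A monotone real straight-line program is monotone in its leaves, wire by wire. [folklore] -/
theorem realProgram_monotone {n T K : ℕ} (ev : (Fin n → Bool) → Fin T → ℝ)
    (hprog : (∀ t : Fin T, ∃ (k : ℕ) (src : Fin k → Fin n ⊕ Fin T) (φ : (Fin k → ℝ) → ℝ), k ≤ K ∧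
      (∀ i t', src i = Sum.inr t' → t' < t) ∧ Monotone φ ∧
      ∀ u : Fin n → Bool, ev u t =
        φ (fun i => Sum.elim (fun j => if u j then (1 : ℝ) else 0) (ev u) (src i)))) :
    ∀ t : Fin T, Monotone fun u => ev u t := by
  suffices H : ∀ m : ℕ, ∀ t : Fin T, t.1 < m → Monotone fun u => ev u t from
    fun t => H (t.1 + 1) t (Nat.lt_succ_self _)
  intro m
  induction m with
  | zero => exact fun t ht => absurd ht (Nat.not_lt_zero _)
  | succ m ih =>
    intro t ht
    by_cases hlt : t.1 < m
    · exact ih t hlt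
    · obtain ⟨k, src, φ, -, hsrc, hmono, hev⟩ := hprog t
      intro u u' huu'
      simp only [hev u, hev u']
      refine hmono fun i => ?_
      cases hsi : src i with
      | inl j =>
        simp only [Sum.elim_inl]
        exact indicator_le_indicator huu' j
      | inr t' =>
        simp only [Sum.elim_inr]
        have ht' : t'.1 < m := by
          have := hsrc i t' hsi
          rw [Fin.lt_def] at this
          omega
        exact ih t' ht' huu'

/-- A gate with the class-program property is monotone (take the identity class map).
[folklore] -/
theorem classProgram_monotone (m c : ℕ) (φ : GateFn)
    (h : ∀ (n' : ℕ) (cls : Fin φ.1 → Fin n'),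
      ∃ (T K : ℕ) (ev : (Fin n' → Bool) → Fin T → ℝ) (t : Fin T) (θ : ℝ),
      T ≤ m ^ c * (n' + 1) ∧ K ≤ ⌊(m : ℝ) ^ (1 / 16 : ℝ)⌋₊ ∧
      (∀ w : Fin T, ∃ (k : ℕ) (src : Fin k → Fin n' ⊕ Fin T) (ψ : (Fin k → ℝ) → ℝ), k ≤ K ∧
      (∀ i t', src i = Sum.inr t' → t' < w) ∧ Monotone ψ ∧
      ∀ u : Fin n' → Bool, ev u w =
      ψ (fun i => Sum.elim (fun j => if u j then (1 : ℝ) else 0) (ev u) (src i))) ∧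
      ∀ u : Fin n' → Bool, φ.2 (fun j => u (cls j)) = true ↔ θ ≤ ev u t) :
    Monotone φ.2 := by
  obtain ⟨T, K, ev, t, θ, -, -, hprog, hiff⟩ := h φ.1 id
  refine monotone_of_forall_iff (fun v => (hiff v)) fun v w hvw hv => ?_
  exact hv.trans (realProgram_monotone ev hprog t hvw)

/-! ## §3 The free classes: small fan-in, few-row CONV, bounded-dimension CONV -/

/-- Eventually `N ≤ ⌊m^{1/16}⌋₊`. [folklore] -/
theorem eventually_le_floor_sixteenth (N : ℕ) : ∀ᶠ m : ℕ in atTop, N ≤ ⌊(m : ℝ) ^ (1 / 16 : ℝ)⌋₊ := by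
  filter_upwards [eventually_ge_atTop ((N + 1) ^ 16)] with m hm
  by_contra hlt
  push Not at hlt
  have h := RealInline.lt_floor_add_one_pow_sixteen m
  have : (⌊(m : ℝ) ^ (1 / 16 : ℝ)⌋₊ + 1) ^ 16 ≤ (N + 1) ^ 16 := Nat.pow_le_pow_left (by omega) 16
  omega

/-- Sandwichability is antitone in the number `A` of admissible distinct child pairs. [folklore] -/
theorem sandwichable_of_card_le {ι : Type} [DecidableEq ι] {r s A A' : ℕ} {P N : Finset (ι → Bool)}
    {ε : ℝ} {φ : GateFn} (h : Sandwichable r s A' P N ε φ) (hA : A ≤ A') :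
    Sandwichable r s A P N ε φ :=
  fun d c hcard hd hc hdc => h d c (hcard.trans hA) hd hc hdc


/-- **GATES OF SMALL FAN-IN HAVE THE CLASS-PROGRAM PROPERTY**: a monotone gate with at most
`⌊m^{1/16}⌋₊` inputs is, for any class map, ONE monotone real gate of arity `φ.1` reading the leaves
`cls j` (a program of length `1` and fan-in `φ.1`). So every MONOTONE gate of fan-in `≤ ⌊m^{1/16}⌋₊`,
whatever its nature (PERM, GRANK, CONV of any width, …), is free. [folklore] -/
theorem smallFanIn_classProgram (m c : ℕ) (φ : GateFn) (hm : 1 ≤ m)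
    (hn : φ.1 ≤ ⌊(m : ℝ) ^ (1 / 16 : ℝ)⌋₊) (hmono : Monotone φ.2) :
    ∀ (n' : ℕ) (cls : Fin φ.1 → Fin n'),
    ∃ (T K : ℕ) (ev : (Fin n' → Bool) → Fin T → ℝ) (t : Fin T) (θ : ℝ),
    T ≤ m ^ c * (n' + 1) ∧ K ≤ ⌊(m : ℝ) ^ (1 / 16 : ℝ)⌋₊ ∧
    (∀ w : Fin T, ∃ (k : ℕ) (src : Fin k → Fin n' ⊕ Fin T) (ψ : (Fin k → ℝ) → ℝ), k ≤ K ∧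
    (∀ i t', src i = Sum.inr t' → t' < w) ∧ Monotone ψ ∧
    ∀ u : Fin n' → Bool, ev u w =
    ψ (fun i => Sum.elim (fun j => if u j then (1 : ℝ) else 0) (ev u) (src i))) ∧
    ∀ u : Fin n' → Bool, φ.2 (fun j => u (cls j)) = true ↔ θ ≤ ev u t := by
  classical
  intro n' cls
  have hT : 1 ≤ m ^ c * (n' + 1) :=
    le_trans (Nat.one_le_pow _ _ hm) (Nat.le_mul_of_pos_right _ (Nat.succ_pos _))
  -- reading a real vector back as Booleans at level `1`
  have hread : ∀ u : Fin n' → Bool,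
      (fun j => decide ((1 : ℝ) ≤ if u (cls j) then (1 : ℝ) else 0)) = fun j => u (cls j) := by
    intro u; funext j; cases u (cls j) <;> simp
  refine ⟨1, φ.1,
    fun u _ => if φ.2 (fun j => decide ((1 : ℝ) ≤ if u (cls j) then (1 : ℝ) else 0)) then 1 else 0,
    ⟨0, Nat.one_pos⟩, 1, hT, hn,
    fun w => ⟨φ.1, fun j => Sum.inl (cls j),
      fun z => if φ.2 (fun j => decide ((1 : ℝ) ≤ z j)) then 1 else 0, le_rfl,
      fun i t' h => by simp at h, fun z z' hzz' => ?_, fun u => by simp only [Sum.elim_inl]; rfl⟩,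
    fun u => ?_⟩
  · -- monotonicity of the reading gate
    have hle : (fun j => decide ((1 : ℝ) ≤ z j)) ≤ fun j => decide ((1 : ℝ) ≤ z' j) := by
      intro j
      by_cases h : (1 : ℝ) ≤ z j
      · simp [h, h.trans (hzz' j)]
      · simp [h]
    have hφle := hmono hle
    show (if φ.2 (fun j => decide ((1 : ℝ) ≤ z j)) then (1 : ℝ) else 0) ≤
      if φ.2 (fun j => decide ((1 : ℝ) ≤ z' j)) then (1 : ℝ) else 0
    by_cases ha : φ.2 (fun j => decide ((1 : ℝ) ≤ z j)) = true
    · rw [if_pos ha, if_pos (eq_true_of_le_of_eq_true hφle ha)]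
    · rw [if_neg ha]
      split_ifs <;> norm_num
  · -- the threshold at level `1`
    show φ.2 (fun j => u (cls j)) = true ↔
      (1 : ℝ) ≤ if φ.2 (fun j => decide ((1 : ℝ) ≤ if u (cls j) then (1 : ℝ) else 0)) then (1 : ℝ) else 0
    rw [hread u]
    by_cases h : φ.2 (fun j => u (cls j)) = true
    · rw [if_pos h]; simp [h]
    · rw [if_neg h]; simp [h]

/-- **MONOTONE GATES OF FAN-IN `≤ ⌊m^{1/16}⌋₊` ARE SANDWICHABLE** (any gate class).
[cite: Jukna2012, Thm. 9.21] -/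
theorem smallFanIn_statement : ∀ c : ℕ, ∃ r₀ s₀ : ℕ, 2 ≤ r₀ ∧ 2 ≤ s₀ ∧ ∀ r s : ℕ,
    r₀ ≤ r → s₀ ≤ s → ∀ᶠ m : ℕ in atTop, ∀ φ : GateFn,
      (φ.1 ≤ ⌊(m : ℝ) ^ (1 / 16 : ℝ)⌋₊ ∧ Monotone φ.2) →
      Sandwichable r s (m ^ (c + 3)) (posFam m) (negFam m) (eps m c) φ := by
  intro c
  obtain ⟨r₀, s₀, hr₀, hs₀, hG⟩ := realGate_statement c
  refine ⟨r₀, s₀, hr₀, hs₀, fun r s hr hs => ?_⟩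
  filter_upwards [hG r s hr hs, eventually_ge_atTop 1] with m hm h1 φ hφ
  exact hm φ (smallFanIn_classProgram m c φ h1 hφ.1 hφ.2)

/-- **CONV GATES WITH FEW ROWS ARE SANDWICHABLE**: `p ≤ ⌊m^{1/16}⌋₊` constraint rows, any psd
dimension, width `≤ m^c` (`ConvFewRows.conv_fewRows_classProgram` + `realGate_statement`).
[cite: Jukna2012, Thm. 9.21] -/
theorem fewRowsConv_statement : ∀ c : ℕ, ∃ r₀ s₀ : ℕ, 2 ≤ r₀ ∧ 2 ≤ s₀ ∧ ∀ r s : ℕ,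
    r₀ ≤ r → s₀ ≤ s → ∀ᶠ m : ℕ in atTop, ∀ φ : GateFn,
      (∃ p q : ℕ, p + q ≤ m ^ c ∧ p ≤ ⌊(m : ℝ) ^ (1 / 16 : ℝ)⌋₊ ∧
          ∃ (A : Fin p → Matrix (Fin q) (Fin q) ℝ) (b : Fin p → ℝ) (B : Fin p → Fin φ.1 → ℝ),
            (∀ i j, 0 ≤ B i j) ∧ ∀ v : Fin φ.1 → Bool, φ.2 v = true ↔
              ∃ Y : Matrix (Fin q) (Fin q) ℝ, Y.PosSemidef ∧
                ∀ i, (A i * Y).trace ≤ b i + ∑ j, B i j * (if v j then (1 : ℝ) else 0)) →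
      Sandwichable r s (m ^ (c + 3)) (posFam m) (negFam m) (eps m c) φ := by
  intro c
  obtain ⟨r₀, s₀, hr₀, hs₀, hG⟩ := realGate_statement c
  refine ⟨r₀, s₀, hr₀, hs₀, fun r s hr hs => ?_⟩
  filter_upwards [hG r s hr hs, eventually_le_floor_sixteenth 2] with m hm hF φ hφ
  exact hm φ (ConvFewRows.conv_fewRows_classProgram m c φ hF hφ)

/-- **CONV GATES OF BOUNDED PSD DIMENSION ARE SANDWICHABLE**: psd dimension `q ≤ Q`, any number of rows,
width `≤ m^c` (`ConvBoundedDim.conv_boundedDim_classProgram` at exponent `c' = (c+1)(Q²+2)+1`,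
`realGate_statement c'`, then weaken `A` and `ε`). [cite: Jukna2012, Thm. 9.21] -/
theorem boundedDimConv_statement (Q : ℕ) : ∀ c : ℕ, ∃ r₀ s₀ : ℕ, 2 ≤ r₀ ∧ 2 ≤ s₀ ∧ ∀ r s : ℕ,
    r₀ ≤ r → s₀ ≤ s → ∀ᶠ m : ℕ in atTop, ∀ φ : GateFn,
      (∃ p q : ℕ, p + q ≤ m ^ c ∧ q ≤ Q ∧
          ∃ (A : Fin p → Matrix (Fin q) (Fin q) ℝ) (b : Fin p → ℝ) (B : Fin p → Fin φ.1 → ℝ),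
            (∀ i j, 0 ≤ B i j) ∧ ∀ v : Fin φ.1 → Bool, φ.2 v = true ↔
              ∃ Y : Matrix (Fin q) (Fin q) ℝ, Y.PosSemidef ∧
                ∀ i, (A i * Y).trace ≤ b i + ∑ j, B i j * (if v j then (1 : ℝ) else 0)) →
      Sandwichable r s (m ^ (c + 3)) (posFam m) (negFam m) (eps m c) φ := by
  intro c
  set c' : ℕ := (c + 1) * (Q * Q + 2) + 1 with hc'
  obtain ⟨r₀, s₀, hr₀, hs₀, hG⟩ := realGate_statement c'
  refine ⟨r₀, s₀, hr₀, hs₀, fun r s hr hs => ?_⟩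
  filter_upwards [hG r s hr hs, eventually_le_floor_sixteenth (max 2 (Q * Q + 1)),
    eventually_ge_atTop 2] with m hm hF hm2 φ hφ
  have hS : Sandwichable r s (m ^ (c' + 3)) (posFam m) (negFam m) (eps m c') φ :=
    hm φ (ConvBoundedDim.conv_boundedDim_classProgram Q m c φ hF hm2 hφ)
  have hcc' : c ≤ c' := by rw [hc']; nlinarith
  refine (sandwichable_of_card_le hS (Nat.pow_le_pow_right (by omega) (by omega))).of_le ?_
  unfold eps
  have h1 : (1 : ℝ) ≤ m := by exact_mod_cast (by omega : 1 ≤ m)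
  have hpow : (m : ℝ) ^ (c + 1) ≤ (m : ℝ) ^ (c' + 1) := pow_le_pow_right₀ h1 (by omega)
  have hpos : (0 : ℝ) < 8 * (m : ℝ) ^ (c + 1) := by positivity
  exact one_div_le_one_div_of_le hpos (by linarith)

/-! ## §4 The unconditional lower bound -/

/-- Every gate of the r6 class is monotone. [folklore] -/
theorem realGates_monotone (Q c m : ℕ) (φ : GateFn)
    (hφ : (∀ (n' : ℕ) (cls : Fin φ.1 → Fin n'),
      ∃ (T K : ℕ) (ev : (Fin n' → Bool) → Fin T → ℝ) (t : Fin T) (θ : ℝ),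
      T ≤ m ^ c * (n' + 1) ∧ K ≤ ⌊(m : ℝ) ^ (1 / 16 : ℝ)⌋₊ ∧
      (∀ w : Fin T, ∃ (k : ℕ) (src : Fin k → Fin n' ⊕ Fin T) (ψ : (Fin k → ℝ) → ℝ), k ≤ K ∧
      (∀ i t', src i = Sum.inr t' → t' < w) ∧ Monotone ψ ∧
      ∀ u : Fin n' → Bool, ev u w =
      ψ (fun i => Sum.elim (fun j => if u j then (1 : ℝ) else 0) (ev u) (src i))) ∧
      ∀ u : Fin n' → Bool, φ.2 (fun j => u (cls j)) = true ↔ θ ≤ ev u t) ∨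
      (∃ p q : ℕ, p + q ≤ m ^ c ∧ p ≤ ⌊(m : ℝ) ^ (1 / 16 : ℝ)⌋₊ ∧
          ∃ (A : Fin p → Matrix (Fin q) (Fin q) ℝ) (b : Fin p → ℝ) (B : Fin p → Fin φ.1 → ℝ),
            (∀ i j, 0 ≤ B i j) ∧ ∀ v : Fin φ.1 → Bool, φ.2 v = true ↔
              ∃ Y : Matrix (Fin q) (Fin q) ℝ, Y.PosSemidef ∧
                ∀ i, (A i * Y).trace ≤ b i + ∑ j, B i j * (if v j then (1 : ℝ) else 0)) ∨
      (∃ p q : ℕ, p + q ≤ m ^ c ∧ q ≤ Q ∧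
          ∃ (A : Fin p → Matrix (Fin q) (Fin q) ℝ) (b : Fin p → ℝ) (B : Fin p → Fin φ.1 → ℝ),
            (∀ i j, 0 ≤ B i j) ∧ ∀ v : Fin φ.1 → Bool, φ.2 v = true ↔
              ∃ Y : Matrix (Fin q) (Fin q) ℝ, Y.PosSemidef ∧
                ∀ i, (A i * Y).trace ≤ b i + ∑ j, B i j * (if v j then (1 : ℝ) else 0)) ∨
      (φ.1 ≤ ⌊(m : ℝ) ^ (1 / 16 : ℝ)⌋₊ ∧ Monotone φ.2) ∨
      (IsPermGate (TT m) φ ∨ IsGRankGate (TT m) φ)) :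
    Monotone φ.2 := by
  rcases hφ with h | h | h | h | h
  · exact classProgram_monotone m c φ h
  · obtain ⟨p, q, hpq, -, A, b, B, hB, hrep⟩ := h
    exact IsConvGate.monotone ⟨p, q, hpq, A, b, B, hB, hrep⟩
  · obtain ⟨p, q, hpq, -, A, b, B, hB, hrep⟩ := h
    exact IsConvGate.monotone ⟨p, q, hpq, A, b, B, hB, hrep⟩
  · exact h.2
  · exact h.elim IsPermGate.monotone IsGRankGate.monotone

/-- **REAL-PROGRAM GATES, FEW-ROW CONV GATES AND BOUNDED-DIMENSION CONV GATES ARE FREE** (registered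
helper `realGates_lowerBound`). For every `Q` and `c`, eventually in `m`, no circuit with `≤ m^c` gates
over `{∧₂, ∨₂}` together with ALL of: gates with the class-program property at exponent `c` (short
monotone real straight-line programs of fan-in `≤ ⌊m^{1/16}⌋₊` over their merged children), CONV gates
of width `≤ m^c` with `≤ ⌊m^{1/16}⌋₊` rows or with psd dimension `≤ Q`, MONOTONE gates of ANY kind of
fan-in `≤ ⌊m^{1/16}⌋₊`, and PERM/GRANK gates of width `≤ ⌊m^{1/16}⌋₊`, computes `CLIQUE(m, ⌈m^{1/4}⌉₊)`. [cite: Jukna2012, Thm. 9.21] -/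
theorem realGates_lowerBound : ∀ Q c : ℕ, ∀ᶠ m : ℕ in atTop,
    ∀ C : Circuit ((⊤ : SimpleGraph (Fin m)).edgeSet),
      C.IsOver (monotoneBasis ∪ {φ |
        (∀ (n' : ℕ) (cls : Fin φ.1 → Fin n'),
        ∃ (T K : ℕ) (ev : (Fin n' → Bool) → Fin T → ℝ) (t : Fin T) (θ : ℝ),
        T ≤ m ^ c * (n' + 1) ∧ K ≤ ⌊(m : ℝ) ^ (1 / 16 : ℝ)⌋₊ ∧
        (∀ w : Fin T, ∃ (k : ℕ) (src : Fin k → Fin n' ⊕ Fin T) (ψ : (Fin k → ℝ) → ℝ), k ≤ K ∧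
        (∀ i t', src i = Sum.inr t' → t' < w) ∧ Monotone ψ ∧
        ∀ u : Fin n' → Bool, ev u w =
        ψ (fun i => Sum.elim (fun j => if u j then (1 : ℝ) else 0) (ev u) (src i))) ∧
        ∀ u : Fin n' → Bool, φ.2 (fun j => u (cls j)) = true ↔ θ ≤ ev u t) ∨
        (∃ p q : ℕ, p + q ≤ m ^ c ∧ p ≤ ⌊(m : ℝ) ^ (1 / 16 : ℝ)⌋₊ ∧
          ∃ (A : Fin p → Matrix (Fin q) (Fin q) ℝ) (b : Fin p → ℝ) (B : Fin p → Fin φ.1 → ℝ),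
            (∀ i j, 0 ≤ B i j) ∧ ∀ v : Fin φ.1 → Bool, φ.2 v = true ↔
              ∃ Y : Matrix (Fin q) (Fin q) ℝ, Y.PosSemidef ∧
                ∀ i, (A i * Y).trace ≤ b i + ∑ j, B i j * (if v j then (1 : ℝ) else 0)) ∨
        (∃ p q : ℕ, p + q ≤ m ^ c ∧ q ≤ Q ∧
          ∃ (A : Fin p → Matrix (Fin q) (Fin q) ℝ) (b : Fin p → ℝ) (B : Fin p → Fin φ.1 → ℝ),
            (∀ i j, 0 ≤ B i j) ∧ ∀ v : Fin φ.1 → Bool, φ.2 v = true ↔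
              ∃ Y : Matrix (Fin q) (Fin q) ℝ, Y.PosSemidef ∧
                ∀ i, (A i * Y).trace ≤ b i + ∑ j, B i j * (if v j then (1 : ℝ) else 0)) ∨
        (φ.1 ≤ ⌊(m : ℝ) ^ (1 / 16 : ℝ)⌋₊ ∧ Monotone φ.2) ∨
        (IsPermGate ⌊(m : ℝ) ^ (1 / 16 : ℝ)⌋₊ φ ∨ IsGRankGate ⌊(m : ℝ) ^ (1 / 16 : ℝ)⌋₊ φ)}) →
      C.size ≤ m ^ c → ¬ C.Computes (cliqueFn m ⌈(m : ℝ) ^ (1 / 4 : ℝ)⌉₊) :=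
  fun Q => ThresholdLowerBound.lowerBound_of_statement (ThresholdLowerBound.union_statement
    realGate_statement <| ThresholdLowerBound.union_statement fewRowsConv_statement <|
    ThresholdLowerBound.union_statement (boundedDimConv_statement Q) <|
    ThresholdLowerBound.union_statement smallFanIn_statement narrowAlgebraic_statement)
    (realGates_monotone Q)

end Summit.PneNP.PneNP.Theorems.CliqueExtLowerBound.WidthThreshold.RealGateLowerBound

end
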